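import Literature.MathematicalPhysics.QuantumFieldTheory.Federbush1986.CubeCutoffs
import Literature.MathematicalPhysics.QuantumFieldTheory.Federbush1986.PhaseCellIVGaugeInterpolation
import Literature.MathematicalPhysics.QuantumFieldTheory.Federbush1986.PhaseCellIVCompactGroupTargets
import Literature.Analysis.Calculus.RegularLevelSetSubmanifold

/-!
# `Federbush1986.PhaseCellIVGeomConstruction5` — [Federbush1988PhaseCellIV] §11 **Geometric Construction 5** (11.10)–(11.11)
# p. 338 (the smoothing `ᵉˢφ′` of a gauge extended to a hypercube, with `|D^α ᵉˢφ′(x)| ≤ c_α d(x, ∂D)^{−(|α|−1)} Λ₁(ᵉφ′)`) =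
# Theorem A.3 ON THE UNIT CUBE — PROVED for every uniformly smoothly retractable target `M ⊆ R^t`, hence for every compact
# `C^∞` submanifold, every compact matrix group (`U(N)`, `SU(N)`, `ρ(G)`) and the spheres, hypothesis-free

statement-level skeleton of published theorems with citation tags; proofs where landed; nothing here is a claim about the Yang–Mills mass gap

CITATION HEADER.  P. Federbush, *A phase cell approach to Yang–Mills theory. IV. The choice of variables*, Commun. Math.
Phys. **114** (1988) 317–343 [Federbush1988PhaseCellIV], §11 «Gauge interpolation» p. 338 and Appendix A part C, Theorem A.3
with its proof (A.27)–(A.31) p. 342, «Caution» p. 339 (renders f4-p022/f4-p023/f4-p026 of unit `lit-balaban-r19`, read as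
images).  Cell `lit-balaban`, Phase-2 proof seat **r19 gen 11** (F4 fold owner, `ROWS-F4.md`); SKELETON row **F4.Def§11**, cell
Geometric Construction 5 — decl `PhaseCellIVGauge.GeomConstruction5 k t M` (typed p314251, `PhaseCellIVGaugeInterpolation` §5).
Inputs BY NAME: `DyadicSmoothing.CutoffSystem` + `CubeCutoffs.cubeSystem` (r19 g11, engines 1–2/3), `PhaseCellIVThmA3Retract`
(p261759: `exists_root_scale`, `norm_iteratedFDeriv_comp_le_of_scale` — the chain rule keeping one factor `Λ₁`),
`SubmanifoldTubularRetraction` (p299101: `exists_smooth_retraction_euclidean`), `ClosedSubgroupSubmanifold` (p302712),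
`PhaseCellIVCompactGroupTargets` (p305705: `range_hyps`, `unitaryGroup_hyps`, `specialUnitaryGroup_hyps`),
`RegularLevelSetSubmanifold` (p299970: `isSubmanifoldOfDim_euclidean_sphere`), Mathlib `LipschitzOnWith.extend_finite_dimension`.

WHAT IS PRINTED (p. 338, verbatim).  «In this case we modify this `ᵉφ′(x)` defined on `H` to `ᵉˢφ′(x)` defined on `H` [this
becomes the `φ′(x)` of (11.3)].  `ᵉˢφ′` is a smoothing of `ᵉφ′`.  *Geometric Construction 5.* `ᵉˢφ′(x)` satisfies a) `ᵉˢφ′(x) =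
ᵉφ′(x)`, `x ∈ ∂H`, (11.10) b) `|D^α ᵉˢφ′(x)| ≤ c_α (1/(d(x, ∂D))^{|α|−1}) Λ₁(ᵉφ′)`, (11.11) where the norm on derivatives in
the left side of (11.11) is any reasonable `L_∞` norm.»  Appendix A part C («Geometric Construction 5») proves this as Theorem
A.3 for the unit BALL: «`f^s` will be `f_ε` followed by the normal projection onto `M`», `f_ε(x) = ∫ w^{εd(x)}(x − y) f(y) dy`
(A.30) with `d ∈ C^∞`, `½d(x, ∂B) ≤ d(x) ≤ d(x, ∂B)` (A.29); p. 339 «Caution. The geometric theorems of Appendix A, require a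
universal bound on `Λ₁` of `φ`'s (as scaled to unit scale)».

WHAT THIS FILE PROVES.  `geomConstruction5_of_retract`: **`GeomConstruction5 k t M` — Theorem A.3 on the unit `k`-cube, capped
as typed — holds for every `k` and every `M ⊆ R^t` admitting a uniform smooth neighbourhood retraction** (`r > 0`, `P ∈ C^∞`
with `P(y) ∈ M` for `d(y, M) < r`, `P = id` on `M`, `‖D^iP‖ ≤ C_i` on `{d(·, M) < r}` = print's «normal projection onto `M` …
defined in a neighborhood of `M`»); `geomConstruction5_of_submanifold`: hence for EVERY COMPACT `C^∞` SUBMANIFOLD `M ⊂ R^t`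
(tubular-neighbourhood theorem of the tree, p299101); `geomConstruction5_of_isCompact_subgroup` / `_range_of_compact` /
`_unitaryGroup` / `_specialUnitaryGroup` / `_sphere`: print's targets `M = G` a compact (gauge) group, hypothesis-free.
PROOF = print's, step by step, on the cube: extend `ᵉφ′ : D → M ⊂ R^t` to a Lipschitz `ḡ : ℝᵏ → R^t` (constant `L_tΛ₁`);
`f_ε := smooth ε ḡ` — the mollification (A.30) at scale `≍ εm(x)`, `m(x) = min_i min(x_i, 1 − x_i)`, realised with the PRODUCT
dyadic cutoffs of `CubeCutoffs` through the generic engine `DyadicSmoothing` (print's `d ∈ C^∞` of (A.29) is replaced by cutoffs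
that are smooth by construction — on a cube a `C^∞` function comparable to `d(x, ∂D)` up to the boundary does not exist); `ε =
ε(c₁, r)` so small that `‖f_ε − ᵉφ′‖ ≤ 4εL_tΛ₁ < r` on `D` ((A.31), this is where the cap `Λ₁ ≤ c₁` enters) and `ε ≤ ¼`
(locality); `ᵉˢφ′ := P ∘ f_ε`; (11.10) since `f_ε = ᵉφ′` on `∂D` (`m = 0` there) and `P = id` on `M`; continuity on `D`, `C^∞` on
the open cube; (11.11) from `DyadicSmoothing.CutoffSystem.exists_deriv_bound` (`‖D^if_ε‖ ≤ AΛ₁m^{1−i}`), the chain rule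
`norm_iteratedFDeriv_comp_le_of_scale` keeping ONE factor `Λ₁`, and `d(x, ∂D) ≤ m(x)` (`CubeCutoffs.infDist_cubeBoundary_le_msize`).
The case `k = 0` (a point, `∂D = ∅`) is separate and trivial.

WHAT THIS MODULE PROVIDES (namespace `PhaseCellIVGauge`): theorems `exists_lipschitz_extension_cube`, `norm_eq_zero_of_dim_zero`,
`zero_mem_unitCube`, `zero_mem_cubeBoundary`, **`geomConstruction5_of_retract`**, **`geomConstruction5_of_submanifold`**,
`geomConstruction5_of_isCompact_subgroup`, `geomConstruction5_range_of_compact`, `geomConstruction5_unitaryGroup`,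
`geomConstruction5_specialUnitaryGroup`, `geomConstruction5_sphere`.  No definitions, no named facts; axioms standard.
-/

namespace Literature.MathematicalPhysics.QuantumFieldTheory.Federbush1986

noncomputable section

open MeasureTheory Metric Set Filter Function
open scoped ContDiff Topology NNReal

namespace PhaseCellIVGauge

open LipschitzMollifier (Euc)
open DyadicSmoothing CubeCutoffs PhaseCellIVAppA PhaseCellIVAppA.Retract
open Literature.AlgebraicGeometry.RealAlgebraic Literature.Analysis.Calculus

variable {k t : ℕ}

/-! ## §1 Lipschitz extension of the datum and the degenerate dimension -/

/-- «view `f` as a map from `B` into `R^t`» (here from the cube `D`) and extend it to `ℝᵏ` keeping a Lipschitz bound (Mathlib's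
finite-dimensional extension, constant `L_t·Λ₁`). [cite: Federbush1988PhaseCellIV, proof of Theorem A.3 p. 342] -/
theorem exists_lipschitz_extension_cube {M : Set (Euc t)} (f : ↥(unitCube k) → ↥M) {K : ℝ≥0}
    (hf : LipschitzWith K f) : ∃ g : Euc k → Euc t, LipschitzWith (lipschitzExtensionConstant (Euc t) * K) g ∧
      ∀ x : ↥(unitCube k), g x = (f x : Euc t) := by
  classical
  set g₁ : Euc k → Euc t := fun x => if hx : x ∈ unitCube k then (f ⟨x, hx⟩ : Euc t) else 0 with hg₁
  have hg₁L : LipschitzOnWith K g₁ (unitCube k) := by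
    intro x hx y hy
    simp only [hg₁, dif_pos hx, dif_pos hy]
    have := (LipschitzWith.subtype_val M).comp hf
    rw [one_mul] at this
    exact this.edist_le_mul ⟨x, hx⟩ ⟨y, hy⟩
  obtain ⟨g, hg, heq⟩ := hg₁L.extend_finite_dimension
  refine ⟨g, hg, fun x => ?_⟩
  have := heq x.2
  simp only [hg₁, dif_pos x.2] at this
  exact this.symm

/-- `ℝ⁰` is a point: every vector has norm `0`. [cite: Federbush1988PhaseCellIV, Appendix A p. 339] -/
theorem norm_eq_zero_of_dim_zero (y : Euc 0) : ‖y‖ = 0 := by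
  rw [EuclideanSpace.norm_eq]
  simp

/-- The origin is a vertex of the unit cube. [cite: Federbush1988PhaseCellIV, Appendix A p. 339] -/
theorem zero_mem_unitCube (k : ℕ) : (0 : Euc k) ∈ unitCube k := fun i => by simp

/-- For `k ≥ 1` the origin lies on `∂D` (so `∂D ≠ ∅`). [cite: Federbush1988PhaseCellIV, Appendix A p. 339] -/
theorem zero_mem_cubeBoundary [NeZero k] : (0 : Euc k) ∈ cubeBoundary k :=
  CubeBall.mem_cubeBoundary_iff.mpr ⟨zero_mem_unitCube k, ⟨⟨0, Nat.pos_of_ne_zero (NeZero.ne k)⟩, Or.inl (by simp)⟩⟩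

/-! ## §2 Geometric Construction 5 for uniformly smoothly retractable targets -/

/-- **Geometric Construction 5 of [Federbush1988PhaseCellIV] §11 (= Theorem A.3 on the unit `k`-cube, decl `GeomConstruction5`,
with the p. 339 «Caution» cap) for every target `M ⊆ R^t` that is a uniform smooth neighbourhood retract**: given `r > 0` and a
`C^∞` map `P : R^t → R^t` with `P(y) ∈ M` for `d(y, M) < r`, `P = id` on `M` and `‖D^iP‖ ≤ C_i` on `{d(·, M) < r}` (print's
normal projection «defined in a neighborhood of `M`»), for every cap `c₁` there are constants `c_m` such that every
`ᵉφ′ : D → M` with `Λ₁(ᵉφ′) ≤ c₁` has a smoothing `ᵉˢφ′ = P ∘ f_ε` with (11.10) `ᵉˢφ′ = ᵉφ′` on `∂D`, continuous on `D`, `C^∞` on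
the open cube, and (11.11) `‖D^m ᵉˢφ′(x)‖ ≤ c_m d(x, ∂D)^{−(m−1)} Λ₁(ᵉφ′)`. [cite: Federbush1988PhaseCellIV, Geometric
Construction 5 (11.10)–(11.11) p. 338; Theorem A.3 (A.25)–(A.26), (A.27)–(A.31) p. 342; «Caution» p. 339] -/
theorem geomConstruction5_of_retract {M : Set (EuclideanSpace ℝ (Fin t))}
    {P : EuclideanSpace ℝ (Fin t) → EuclideanSpace ℝ (Fin t)} {r : ℝ} (hr : 0 < r) (hP : ContDiff ℝ ∞ P)
    (hPM : ∀ y, infDist y M < r → P y ∈ M) (hPid : ∀ y ∈ M, P y = y)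
    (hPb : ∀ i : ℕ, ∃ C : ℝ, ∀ y, infDist y M < r → ‖iteratedFDeriv ℝ i P y‖ ≤ C) (k : ℕ) :
    GeomConstruction5 k t M := by
  rcases Nat.eq_zero_or_pos k with rfl | hk
  · -- dimension `0`: `D` is a point, `∂D = ∅`, all derivatives of positive order vanish
    intro c₁
    refine ⟨fun _ => 0, fun eφ _ => ?_⟩
    have hzero : ∀ y : Euc 0, y = 0 := fun y => norm_eq_zero.mp (norm_eq_zero_of_dim_zero y)
    have h0 : (0 : Euc 0) ∈ unitCube 0 := zero_mem_unitCube 0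
    refine ⟨fun _ => (eφ ⟨0, h0⟩ : Euc t), fun x _ => (eφ ⟨0, h0⟩).2, fun x => ?_, continuousOn_const, contDiffOn_const,
      fun m hm K _ _ x _ => ?_⟩
    · have hx : (⟨x.1, cubeBoundary_subset 0 x.2⟩ : ↥(unitCube 0)) = ⟨0, h0⟩ := Subtype.ext (hzero x.1)
      rw [hx]
    · rw [iteratedFDeriv_const_of_ne (by omega : m ≠ 0), Pi.zero_apply, norm_zero]
      exact mul_nonneg (mul_nonneg (le_of_eq rfl) (pow_nonneg (inv_nonneg.2 infDist_nonneg) _)) K.coe_nonneg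
  · haveI : NeZero k := ⟨hk.ne'⟩
    intro c₁
    -- constants
    set L : ℝ≥0 := lipschitzExtensionConstant (Euc t) with hL
    set ε : ℝ := min (1 / 4) (r / (8 * (L * c₁ + 1))) with hε_def
    have hε : 0 < ε := lt_min (by norm_num) (by positivity)
    have hε4 : ε ≤ 1 / 4 := min_le_left _ _
    have hεr : 4 * ε * (L * c₁) < r := by
      have h1 : ε ≤ r / (8 * (L * c₁ + 1)) := min_le_right _ _
      have h2 : 4 * ε * (L * c₁) ≤ 4 * (r / (8 * (L * c₁ + 1))) * (L * c₁) := by gcongr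
      have h3 : 4 * (r / (8 * (L * c₁ + 1))) * (L * c₁) < r := by
        rw [show 4 * (r / (8 * (L * c₁ + 1))) * (L * c₁) = r * (L * c₁ / (2 * (L * c₁ + 1))) by field_simp; ring]
        have : (L * c₁ : ℝ) / (2 * (L * c₁ + 1)) < 1 := by
          rw [div_lt_one (by positivity)]; nlinarith [L.coe_nonneg, c₁.coe_nonneg, mul_nonneg L.coe_nonneg c₁.coe_nonneg]
        nlinarith
      exact lt_of_le_of_lt h2 h3
    have hA : ∀ m : ℕ, ∃ A : ℝ, 0 ≤ A ∧ ∀ (g : Euc k → Euc t) (K : ℝ≥0), LipschitzWith K g → ∀ i, 1 ≤ i → i ≤ m →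
        ∀ x, 0 < (cubeSystem k).σ x →
          ‖iteratedFDeriv ℝ i ((cubeSystem k).smooth ε g) x‖ ≤ A * K * (((cubeSystem k).σ x)⁻¹) ^ (i - 1) :=
      fun m => (cubeSystem k).exists_deriv_bound m hε
    choose A hA0 hA using hA
    choose Cf hCf using hPb
    set Cmax : ℕ → ℝ := fun m => ∑ i ∈ Finset.range (m + 1), max (Cf i) 0 with hCmax
    have hCmax_ge : ∀ m i, i ≤ m → Cf i ≤ Cmax m := fun m i hi =>
      (le_max_left _ _).trans (Finset.single_le_sum (f := fun i => max (Cf i) 0) (fun i _ => le_max_right _ _)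
        (by rw [Finset.mem_range]; omega))
    set U : ℕ → ℝ := fun m => max 1 (A m * (L * c₁)) with hU
    refine ⟨fun m => m.factorial * Cmax m * U m ^ (m - 1) * (A m * L), fun eφ hf => ?_⟩
    obtain ⟨K₀, hK₀c, hK₀⟩ := hf
    obtain ⟨g, hgL, hgf⟩ := exists_lipschitz_extension_cube eφ hK₀
    -- the size function of the cube and its basic facts
    have hσ_def : ∀ x, (cubeSystem k).σ x = msize x := fun _ => rfl
    have hσ_le_one : ∀ x, (cubeSystem k).σ x ≤ 1 := (cubeSystem k).σ_le_one
    -- the smoothed map `f_ε` and `ᵉˢφ′ = P ∘ f_ε`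
    set fs' : Euc k → Euc t := (cubeSystem k).smooth ε g with hfs'
    have hclose : ∀ x ∈ unitCube k, infDist (fs' x) M < r := by
      intro x hx
      have hgx : g x ∈ M := by rw [hgf ⟨x, hx⟩]; exact (eφ ⟨x, hx⟩).2
      have h1 : infDist (fs' x) M ≤ dist (fs' x) (g x) := infDist_le_dist_of_mem hgx
      have h2 : dist (fs' x) (g x) ≤ 4 * ε * (L * K₀) * max ((cubeSystem k).σ x) 0 := by
        rw [dist_eq_norm]; exact (cubeSystem k).norm_smooth_sub_le' hε hgL x
      have h3 : max ((cubeSystem k).σ x) 0 ≤ 1 := max_le (hσ_le_one x) zero_le_one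
      have h4 : 4 * ε * ((L : ℝ) * K₀) * max ((cubeSystem k).σ x) 0 ≤ 4 * ε * (L * c₁) * 1 := by gcongr
      linarith
    refine ⟨P ∘ fs', fun x hx => hPM _ (hclose x hx), fun x => ?_, ?_, ?_, fun m hm K hKc hK x hx => ?_⟩
    · -- (11.10) boundary values: `m = 0` on `∂D`, so `f_ε = ᵉφ′` there
      show P ((cubeSystem k).smooth ε g x) = _
      rw [(cubeSystem k).smooth_eq_of_nonpos (msize_nonpos_of_mem_cubeBoundary x.2),
        hgf ⟨x.1, cubeBoundary_subset k x.2⟩]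
      exact hPid _ (eφ _).2
    · -- continuity on the closed cube
      exact (hP.continuous.comp ((cubeSystem k).continuous_smooth hε hgL)).continuousOn
    · -- smoothness on the open cube `= {m > 0}`
      rw [interior_unitCube_eq]
      exact hP.comp_contDiffOn ((cubeSystem k).contDiffOn_smooth hgL.continuous)
    · -- (11.11)
      have hCmax0 : 0 ≤ Cmax m := Finset.sum_nonneg fun i _ => le_max_right _ _
      have hU0 : 0 ≤ U m := le_trans zero_le_one (le_max_left _ _)
      have hxD : x ∈ unitCube k := interior_subset hx
      have hσ : 0 < (cubeSystem k).σ x := by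
        rw [hσ_def, msize_pos_iff_mem_interior]; exact hx
      -- re-extend with the constant `K` of the clause and use locality
      obtain ⟨g', hg'L, hg'f⟩ := exists_lipschitz_extension_cube eφ hK
      have heqOn : EqOn g g' (cubeSystem k).D := fun y hy => by
        rw [cubeSystem_D] at hy
        rw [hgf ⟨y, hy⟩, hg'f ⟨y, hy⟩]
      have hev : (P ∘ fs') =ᶠ[𝓝 x] (P ∘ (cubeSystem k).smooth ε g') := by
        filter_upwards [(cubeSystem k).smooth_eventuallyEq_of_eqOn hε hε4 heqOn hσ] with y hy
        simp only [comp_apply, hfs', hy]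
      rw [(hev.iteratedFDeriv ℝ m).eq_of_nhds]
      -- the chain-rule bound
      have hPt : ∀ i ≤ m, ‖iteratedFDeriv ℝ i P ((cubeSystem k).smooth ε g' x)‖ ≤ Cmax m := by
        intro i hi
        refine (hCf i _ ?_).trans (hCmax_ge m i hi)
        have : (cubeSystem k).smooth ε g' x = fs' x :=
          ((cubeSystem k).smooth_congr_of_eqOn hε hε4 heqOn (by rw [cubeSystem_D]; exact hxD)).symm
        rw [this]; exact hclose x hxD
      have hΦb : ∀ i, 1 ≤ i → i ≤ m →
          ‖iteratedFDeriv ℝ i ((cubeSystem k).smooth ε g') x‖ ≤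
            (A m * (L * K) * (cubeSystem k).σ x) * (((cubeSystem k).σ x)⁻¹) ^ i := by
        intro i hi1 hi
        refine (hA m g' (L * K) hg'L i hi1 hi x hσ).trans (le_of_eq ?_)
        obtain ⟨j, rfl⟩ := Nat.exists_eq_add_of_le' hi1
        rw [Nat.add_sub_cancel, pow_succ, NNReal.coe_mul]
        field_simp
      have hu0 : 0 ≤ A m * (L * K) * (cubeSystem k).σ x := by have := hA0 m; positivity
      have huU : A m * (L * K) * (cubeSystem k).σ x ≤ U m := by
        refine le_trans ?_ (le_max_right _ _)
        calc A m * (L * K) * (cubeSystem k).σ x ≤ A m * (L * c₁) * 1 := by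
              have := hA0 m; have := hσ_le_one x; gcongr
          _ = A m * (L * c₁) := mul_one _
      have hopen : IsOpen {y : Euc k | 0 < (cubeSystem k).σ y} := isOpen_lt continuous_const (cubeSystem k).continuous_σ
      have key := norm_iteratedFDeriv_comp_le_of_scale hopen hσ ((cubeSystem k).contDiffOn_smooth hg'L.continuous) hP hm hσ
        hu0 huU (le_max_left _ _) hPt hΦb
      -- compare `m(x)^{-(m-1)}` with `d(x, ∂D)^{-(m-1)}`
      have hd0 : 0 < infDist x (cubeBoundary k) :=
        (isClosed_frontier.notMem_iff_infDist_pos ⟨0, zero_mem_cubeBoundary⟩).1 fun h => h.2 hx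
      have hdσ : ((cubeSystem k).σ x)⁻¹ ≤ (infDist x (cubeBoundary k))⁻¹ :=
        (inv_le_inv₀ hσ hd0).2 (infDist_cubeBoundary_le_msize hxD)
      obtain ⟨j, rfl⟩ := Nat.exists_eq_add_of_le' hm
      rw [Nat.add_sub_cancel] at key ⊢
      have hσ0 : (cubeSystem k).σ x ≠ 0 := hσ.ne'
      have hc0' : 0 ≤ ((j + 1).factorial : ℝ) * Cmax (j + 1) * U (j + 1) ^ j * (A (j + 1) * L) := by
        have := hA0 (j + 1)
        positivity
      calc ‖iteratedFDeriv ℝ (j + 1) (P ∘ (cubeSystem k).smooth ε g') x‖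
          ≤ (j + 1).factorial * Cmax (j + 1) * U (j + 1) ^ j * (A (j + 1) * (L * K) * (cubeSystem k).σ x) *
              (((cubeSystem k).σ x)⁻¹) ^ (j + 1) := key
        _ = (j + 1).factorial * Cmax (j + 1) * U (j + 1) ^ j * (A (j + 1) * L) * (((cubeSystem k).σ x)⁻¹) ^ j * K := by
            rw [pow_succ]; field_simp
        _ ≤ (j + 1).factorial * Cmax (j + 1) * U (j + 1) ^ j * (A (j + 1) * L) *
              ((infDist x (cubeBoundary k))⁻¹) ^ j * K :=
            mul_le_mul_of_nonneg_right
              (mul_le_mul_of_nonneg_left (pow_le_pow_left₀ (inv_nonneg.2 hσ.le) hdσ j) hc0') K.coe_nonneg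

/-! ## §3 Geometric Construction 5 for every compact `C^∞` submanifold -/

/-- **Geometric Construction 5 of [Federbush1988PhaseCellIV] §11 for every compact `C^∞` submanifold `M ⊂ R^t`** (print's
«compact differentiable manifold (without boundary) … We now embed `M` in some Euclidean space `R^t`»): the normal projection of
(A.31) is the tree's smooth nearest-point retraction `exists_smooth_retraction_euclidean`. [cite: Federbush1988PhaseCellIV,
Geometric Construction 5 (11.10)–(11.11) p. 338; Theorem A.3 (A.31) p. 342] -/
theorem geomConstruction5_of_submanifold {d : ℕ} {M : Set (EuclideanSpace ℝ (Fin t))} (hMc : IsCompact M)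
    (hM : IsSubmanifoldOfDim d (EuclideanSpace.equiv (Fin t) ℝ '' M)) (k : ℕ) : GeomConstruction5 k t M := by
  by_cases hne : M.Nonempty
  · obtain ⟨r, hr, P, hP, hPM, hPid, hPb, -⟩ := exists_smooth_retraction_euclidean hMc hne hM
    exact geomConstruction5_of_retract hr hP hPM hPid hPb k
  · -- empty target: there is no `ᵉφ′ : D → ∅` (the cube contains `0`), the statement is vacuous
    intro c₁
    refine ⟨fun _ => 0, fun eφ _ => ?_⟩
    exact absurd ⟨_, (eφ ⟨0, zero_mem_unitCube k⟩).2⟩ hne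

/-! ## §4 Print's targets: compact (gauge) groups `M = G ⊆ M_N(ℂ) ≅ R^t`, and the spheres -/

section CompactSubgroup

variable {N : ℕ} {H : Set (Matrix (Fin N) (Fin N) ℂ)} (hHc : IsCompact H) (h1 : (1 : Matrix (Fin N) (Fin N) ℂ) ∈ H)
  (hmul : ∀ a ∈ H, ∀ b ∈ H, a * b ∈ H) (hinv : ∀ a ∈ H, ∃ b ∈ H, b * a = 1)
include hHc h1 hmul hinv

/-- **Geometric Construction 5 for a compact matrix group `M = Ψ(H)`**, `H ⊆ M_N(ℂ)` any compact multiplicative group of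
matrices, `Ψ` any real-linear identification `M_N(ℂ) ≅ R^t` (closed-subgroup theorem of the tree, p302712).
[cite: Federbush1988PhaseCellIV, Geometric Construction 5 (11.10)–(11.11) p. 338; §11 p. 337 («`G`»)] -/
theorem geomConstruction5_of_isCompact_subgroup (Ψ : Matrix (Fin N) (Fin N) ℂ ≃L[ℝ] EuclideanSpace ℝ (Fin t)) (k : ℕ) :
    GeomConstruction5 k t (Ψ '' H) := by
  obtain ⟨𝔥, -, -, hE⟩ := isSubmanifoldOfDim_of_isCompact_subgroup hHc h1 hmul hinv
  exact geomConstruction5_of_submanifold (hHc.image Ψ.continuous) (hE Ψ) k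

end CompactSubgroup

/-- **Geometric Construction 5 for `M = Ψ(ρ(G))`**, `G` any compact group, `ρ` any continuous matrix representation.
[cite: Federbush1988PhaseCellIV, Geometric Construction 5 (11.10)–(11.11) p. 338; §11 p. 337] -/
theorem geomConstruction5_range_of_compact {N : ℕ} {G : Type*} [Group G] [TopologicalSpace G] [CompactSpace G]
    (ρ : G →* Matrix (Fin N) (Fin N) ℂ) (hρ : Continuous ρ) (Ψ : Matrix (Fin N) (Fin N) ℂ ≃L[ℝ] EuclideanSpace ℝ (Fin t))
    (k : ℕ) : GeomConstruction5 k t (Ψ '' Set.range ρ) := by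
  obtain ⟨hc, h1, hmul, hinv⟩ := range_hyps ρ hρ
  exact geomConstruction5_of_isCompact_subgroup hc h1 hmul hinv Ψ k

/-- **Geometric Construction 5 for the gauge group `U(N)`**, hypothesis-free. [cite: Federbush1988PhaseCellIV, Geometric
Construction 5 (11.10)–(11.11) p. 338; §11 p. 337] -/
theorem geomConstruction5_unitaryGroup {N : ℕ} (Ψ : Matrix (Fin N) (Fin N) ℂ ≃L[ℝ] EuclideanSpace ℝ (Fin t)) (k : ℕ) :
    GeomConstruction5 k t (Ψ '' (Matrix.unitaryGroup (Fin N) ℂ : Set (Matrix (Fin N) (Fin N) ℂ))) := by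
  obtain ⟨hc, h1, hmul, hinv⟩ := unitaryGroup_hyps N
  exact geomConstruction5_of_isCompact_subgroup hc h1 hmul hinv Ψ k

/-- **Geometric Construction 5 for the gauge group `SU(N)`**, hypothesis-free. [cite: Federbush1988PhaseCellIV, Geometric
Construction 5 (11.10)–(11.11) p. 338; §11 p. 337] -/
theorem geomConstruction5_specialUnitaryGroup {N : ℕ} (Ψ : Matrix (Fin N) (Fin N) ℂ ≃L[ℝ] EuclideanSpace ℝ (Fin t)) (k : ℕ) :
    GeomConstruction5 k t (Ψ '' (Matrix.specialUnitaryGroup (Fin N) ℂ : Set (Matrix (Fin N) (Fin N) ℂ))) := by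
  obtain ⟨hc, h1, hmul, hinv⟩ := specialUnitaryGroup_hyps N
  exact geomConstruction5_of_isCompact_subgroup hc h1 hmul hinv Ψ k

/-- **Geometric Construction 5 for the unit sphere `S^{t−1} ⊂ R^t`** (`SU(2) = S³ ⊂ ℍ = R⁴`, `U(1) = S¹ ⊂ R²`), hypothesis-free.
[cite: Federbush1988PhaseCellIV, Geometric Construction 5 (11.10)–(11.11) p. 338; Theorem A.3 p. 342] -/
theorem geomConstruction5_sphere (k t : ℕ) : GeomConstruction5 k t (sphere (0 : EuclideanSpace ℝ (Fin t)) 1) :=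
  geomConstruction5_of_submanifold (isCompact_sphere 0 1) isSubmanifoldOfDim_euclidean_sphere k

end PhaseCellIVGauge

end

end Literature.MathematicalPhysics.QuantumFieldTheory.Federbush1986
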